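import Mathlib
import Summits.NavierStokesRegularity.NavierStokesRegularity.Theorems.EulerZoomLiouvillePowerGaugeEulerLiouvilleFatCoreExclusion
import Summits.NavierStokesRegularity.NavierStokesRegularity.Theorems.EulerZoomLiouvillePowerGaugeEulerLiouvilleRadialCapacity
import HarnessLib

/-!
# E-TAIL's dust clause — the FAT-CORE MEMBER (`HasFatFastCore ρ V` is excluded in the power-gauge class), unconditionally

Sub-problem `NavierStokesRegularity`, crux `PowerGaugeEulerLiouville` (stmt-NavierStokesRegularity-19832; a crux CLASS of self-similar Euler/NS
strata on the MODEL lattice — not NS regularity, not E).  Seat ns-ezl-w3 g7, plate t55-FAT JOIN (nsreg-p2 g42 ROUND-52 «PROVENANCE» §D v1.3):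
`fatCorePlate : RadialCapacity → FatCoreExclusion ρ` (`…FatCoreExclusion`, this seat) ∘ `Capacity.radialCapacity : RadialCapacity`
(`…RadialCapacity`, ns-sfl-p1 g9, t55-RC).

* `radialCapacity_holds : RadialCapacity` — the def of `…FatCoreDefs` BY NAME (δ-unfolding of sfl-p1's theorem);
* `fatCoreExclusion (hρ : 0 < ρ) (hρ1 : ρ < 1) : FatCoreExclusion ρ` — class-free: `V ∈ C¹` + weighted-energy finiteness + A-gauge ⇒ no cofinal
  `b`-fat fast core;
* `Loc.selfSimilar_ae_eq_zero_of_fatFastCore_profile` (`V ∈ C¹`, `0 < ρ < 1`) and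
  `Loc.selfSimilar_ae_eq_zero_of_fatFastCoreC2_profile` (binders of the E-TAIL members: `0 < ρ ≤ ½`, `V ∈ C²`, face `HasFatFastCore ρ V` BY NAME —
  the LEAD's `IsKinematicTameProfile` alternative 12 filler shape): a class member with a cofinal fat fast core is trivial, `u = 0` a.e.
  Its NEGATION («DUST»: every far fast core is `o(b)`-thin in every direction) is the binder the needle keeps.

WHAT THIS IS NOT: not NS, not E — kills the «cofinal b-fat fast core» stratum of the MODEL-lattice crux class and nothing else; 19832 OPEN;
NS regularity NOT proved.  [nsreg-p2 g42 ROUND-52 §D]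
-/

noncomputable section

open MeasureTheory Set Metric Real Function
open scoped InnerProductSpace RealInnerProductSpace ENNReal NNReal

set_option linter.dupNamespace false

namespace Summit.NavierStokesRegularity.NavierStokesRegularity.Theorems.PowerGaugeEulerLiouville

open Literature.Analysis Literature.Analysis.FluidPDE

/-- **t55-RC by name**: the radial capacity lemma `RadialCapacity` (def of `…FatCoreDefs`) holds — ns-sfl-p1 g9's `Capacity.radialCapacity`.
[nsreg-p2 g42 ROUND-52 §D; folklore (radial length–energy)] -/
theorem radialCapacity_holds : RadialCapacity := Capacity.radialCapacity

/-- **THE FAT-CORE EXCLUSION** (`FatCoreExclusion ρ`, `0 < ρ < 1`), unconditionally: `V ∈ C¹`, finite weighted energy and the A-gauge exclude a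
cofinal `b`-fat fast core. [nsreg-p2 g42 ROUND-52 §D] -/
theorem fatCoreExclusion {ρ : ℝ} (hρ : 0 < ρ) (hρ1 : ρ < 1) : FatCoreExclusion ρ :=
  fatCorePlate ρ hρ hρ1 radialCapacity_holds

/-- **FAT-CORE MEMBER** (`V ∈ C¹`, `0 < ρ < 1`): in the power-gauge class, a backward self-similar member whose profile carries a cofinal `b`-fat
fast core (`HasFatFastCore ρ V`) is trivial: `u = 0` a.e. [nsreg-p2 g42 ROUND-52 §D] -/
theorem Loc.selfSimilar_ae_eq_zero_of_fatFastCore_profile {ρ : ℝ} (hρ : 0 < ρ) (hρ1 : ρ < 1)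
    {u : ℝ → EuclideanSpace ℝ (Fin 3) → EuclideanSpace ℝ (Fin 3)} {p : ℝ → EuclideanSpace ℝ (Fin 3) → ℝ}
    {H : ℝ → EuclideanSpace ℝ (Fin 3) → EuclideanSpace ℝ (Fin 3) →L[ℝ] EuclideanSpace ℝ (Fin 3)} {c : ℝ≥0}
    (hsw : IsSuitableWeakSolutionOn (slab (EuclideanSpace ℝ (Fin 3)) (Iio 0) isOpen_Iio) 0 0 u p)
    (hH : HasWeakSpatialGradientOn (slab (EuclideanSpace ℝ (Fin 3)) (Iio 0) isOpen_Iio) u H)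
    (hgauge : ∀ a : ℝ, 0 < a →
      ENNReal.ofReal (a ^ (2 * ρ)) * cknA a (0 : ℝ × EuclideanSpace ℝ (Fin 3)) u +
          ENNReal.ofReal (a ^ ρ) * cknE a (0 : ℝ × EuclideanSpace ℝ (Fin 3)) H +
        ENNReal.ofReal (a ^ (2 * ρ)) * cknD a (0 : ℝ × EuclideanSpace ℝ (Fin 3)) p ≤ (c : ℝ≥0∞))
    {V : EuclideanSpace ℝ (Fin 3) → EuclideanSpace ℝ (Fin 3)} {P : EuclideanSpace ℝ (Fin 3) → ℝ}
    (hu : ∀ τ : ℝ, τ < 0 → u τ = selfSimilarCollapse (1 / (2 + ρ)) 0 V τ)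
    (hp : ∀ τ : ℝ, τ < 0 → p τ = selfSimilarCollapsePressure (1 / (2 + ρ)) 0 P τ)
    (hV : ContDiff ℝ 1 V)
    (hQ : HasFatFastCore ρ V) :
    uncurry u =ᵐ[volume.restrict (Iio (0 : ℝ) ×ˢ (univ : Set (EuclideanSpace ℝ (Fin 3))))] 0 :=
  Loc.selfSimilar_ae_eq_zero_of_fatFastCore_profile_of_radialCapacity radialCapacity_holds hρ hρ1 hsw hH hgauge hu hp hV hQ

/-- **FAT-CORE MEMBER, E-TAIL binder shape** (`0 < ρ ≤ ½`, `V ∈ C²`; face `HasFatFastCore ρ V` BY NAME — the `IsKinematicTameProfile`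
alternative «fat core» filler): `u = 0` a.e. [nsreg-p2 g42 ROUND-52 §D] -/
theorem Loc.selfSimilar_ae_eq_zero_of_fatFastCoreC2_profile {ρ : ℝ} (hρ : 0 < ρ) (hρ1 : ρ ≤ 1 / 2)
    {u : ℝ → EuclideanSpace ℝ (Fin 3) → EuclideanSpace ℝ (Fin 3)} {p : ℝ → EuclideanSpace ℝ (Fin 3) → ℝ}
    {H : ℝ → EuclideanSpace ℝ (Fin 3) → EuclideanSpace ℝ (Fin 3) →L[ℝ] EuclideanSpace ℝ (Fin 3)} {c : ℝ≥0}
    (hsw : IsSuitableWeakSolutionOn (slab (EuclideanSpace ℝ (Fin 3)) (Iio 0) isOpen_Iio) 0 0 u p)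
    (hH : HasWeakSpatialGradientOn (slab (EuclideanSpace ℝ (Fin 3)) (Iio 0) isOpen_Iio) u H)
    (hgauge : ∀ a : ℝ, 0 < a →
      ENNReal.ofReal (a ^ (2 * ρ)) * cknA a (0 : ℝ × EuclideanSpace ℝ (Fin 3)) u +
          ENNReal.ofReal (a ^ ρ) * cknE a (0 : ℝ × EuclideanSpace ℝ (Fin 3)) H +
        ENNReal.ofReal (a ^ (2 * ρ)) * cknD a (0 : ℝ × EuclideanSpace ℝ (Fin 3)) p ≤ (c : ℝ≥0∞))
    {V : EuclideanSpace ℝ (Fin 3) → EuclideanSpace ℝ (Fin 3)} {P : EuclideanSpace ℝ (Fin 3) → ℝ}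
    (hu : ∀ τ : ℝ, τ < 0 → u τ = selfSimilarCollapse (1 / (2 + ρ)) 0 V τ)
    (hp : ∀ τ : ℝ, τ < 0 → p τ = selfSimilarCollapsePressure (1 / (2 + ρ)) 0 P τ)
    (hV : ContDiff ℝ 2 V)
    (hQ : HasFatFastCore ρ V) :
    uncurry u =ᵐ[volume.restrict (Iio (0 : ℝ) ×ˢ (univ : Set (EuclideanSpace ℝ (Fin 3))))] 0 :=
  Loc.selfSimilar_ae_eq_zero_of_fatFastCore_profile hρ (by linarith) hsw hH hgauge hu hp (hV.of_le one_le_two) hQ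

end Summit.NavierStokesRegularity.NavierStokesRegularity.Theorems.PowerGaugeEulerLiouville

end
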